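import Summits.HodgeConjecture.HodgeConjecture.Theorems.NikulinTwinTransportTwinSimilitudeAlgebraicStubHkLatticeWittAux
import Literature.LinearAlgebra.QuadraticForm.WittExtension
import Mathlib.RingTheory.Localization.Integer
import HarnessLib

/-!
# Route NikulinTwinTransport · crux `TwinSimilitudeAlgebraic` (stmt-HodgeConjecture-13674) —
# stub `stub_hkLatticeWitt` of line `hyperkaehler-nikulin-anchors` (reshape r2)

**Sub-stub A — `HKLatticeWitt` (pure lattice algebra).**  From a projective K3 period `x ∈ Λ_ℂ`
(`(x.x) = 0`, `(x̄.x) > 0`, a positive integral vector orthogonal to `x`) and the SECTOR DATUM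
`J : T_x = trRat x → N_ℚ` (isometric and injective on `T_x`) we build a RATIONAL ISOMETRY `g` of
`(Λ_{K3} ⊕ ⟨−2⟩)_ℚ = ℚ²³` (the `K3^{[2]}` form `k3HilbertForm 2`) carrying the Hilbert-square
period `(x, 0)` to a period `z := g_ℂ(x, 0)` which is INVARIANT under the block swap
`I = Sum.map k3BlockSwap id` and PROJECTIVE.

Proof (helpers in `…StubHkLatticeWittAux`).  (1) The host `N = U³ ⊕ E₈(−2) ⊕ ⟨−2⟩` embeds
isometrically into `ℚ²³` by some `E` (`E₈(−2) ∋ w ↦ (w, w)` diagonally) with `I`-invariant image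
(`exists_hostEmb`).  (2) `σ := E ∘ J ∘ pr₁` on `U := inl(T_x) ⊂ ℚ²³` is an injective isometry, so
Witt's extension theorem (the tree's PROVED `Witt_isometry_extension_holds`; `q` is non-degenerate
on `ℚ²³`, `det = 2`) extends it to `g = τ ∈ O(ℚ²³)`.  (3) `x ∈ T_x ⊗ ℂ` (`mem_span_trRat`), hence
`z = g_ℂ(x, 0)` lies in the complex span of `E(J(T_x))`, which is `I`-invariant.  (4) `g` is real
and isometric, so `q(z) = (x.x) = 0` and `q(z̄, z) = (x̄.x) > 0`; the positive integral `u ⊥ x`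
gives the rational `g(u, 0) ⊥ z` of positive square — clear denominators
(`IsLocalization.exist_integer_multiples_of_finite`).

Prover seat prover-line-stmt-HodgeConjecture-13674-c1-0 (stub worker, stub `stub_hkLatticeWitt`).

## References

* [Iversen1992] B. Iversen, Hyperbolic Geometry, LMS Student Texts 25, CUP 1992, Ch. I §2 Thm. 2.4.
* [Huybrechts2019] D. Huybrechts, Motives of isogenous K3 surfaces, Comment. Math. Helv. 94 (2019),
  §1.
* [Mongardi2011] G. Mongardi, Symplectic involutions on deformations of `K3^[2]`, Cent. Eur. J.
  Math. 10 (2012), Thm. 5.2 and Cor. 5.3.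
* [Huybrechts2016K3] D. Huybrechts, Lectures on K3 Surfaces, CUP 2016, Ch. 3 Def. 2.5, Lemma 3.1.
-/

noncomputable section

set_option linter.dupNamespace false

open scoped Matrix
open Module
open Literature.AlgebraicGeometry.Surfaces Literature.AlgebraicGeometry.Hyperkaehler
open Literature.LinearAlgebra.QuadraticForm

namespace Summit.HodgeConjecture.HodgeConjecture.Theorems.NikulinTwinTransport

open HkLatticeWitt

/-- **Sub-stub A — `HKLatticeWitt`** (registered stub `stub_hkLatticeWitt` of the line
`hyperkaehler-nikulin-anchors`, crux stmt-HodgeConjecture-13674).  From a projective K3 period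
`x ∈ Λ_ℂ` and a sector datum `J : trRat x → N_ℚ` (isometric and injective on `trRat x`): a rational
isometry `g` of `(Λ_{K3} ⊕ ⟨−2⟩)_ℚ` such that `z := g_ℂ(x, 0)` is invariant under the block swap
`I = Sum.map k3BlockSwap id`, satisfies `q(z) = 0 < q(z̄, z)`, and admits a positive integral vector
orthogonal to it.  Witt's extension theorem applied to `E ∘ J ∘ pr₁` on `inl(trRat x)`, `E` the
host embedding. [cite: Iversen1992, Ch. I §2 Thm. 2.4] [cite: Huybrechts2019, §1 (Witt over ℚ)]
[cite: Mongardi2011, Thm. 5.2 and Cor. 5.3] -/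
theorem stub_hkLatticeWitt :
    ∀ (x : K3Index → ℂ), k3Form x x = 0 → 0 < (k3Form (star x) x).re →
      (∃ u : K3Index → ℤ, k3Form (fun i => (u i : ℂ)) x = 0 ∧
          0 < ∑ i, ∑ j, u i * k3Gram i j * u j) →
      ∀ J : (K3Index → ℚ) →ₗ[ℚ] (HostIndex → ℚ),
        (∀ v ∈ trRat x, ∀ w ∈ trRat x, hostFormRat (J v) (J w) = k3FormRat v w) →
        (∀ v ∈ trRat x, J v = 0 → v = 0) →
        ∃ (g : (K3HilbertIndex → ℚ) ≃ₗ[ℚ] (K3HilbertIndex → ℚ)) (z : K3HilbertIndex → ℂ),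
          (∀ v w : K3HilbertIndex → ℚ,
              k3HilbertForm 2 (fun i => ((g v i : ℚ) : ℂ)) (fun i => ((g w i : ℚ) : ℂ)) =
                k3HilbertForm 2 (fun i => ((v i : ℚ) : ℂ)) (fun i => ((w i : ℚ) : ℂ))) ∧
          (LinearMap.toMatrix' g.toLinearMap).map (fun q : ℚ => (q : ℂ)) *ᵥ Sum.elim x 0 = z ∧
          (∀ i, z (Sum.map k3BlockSwap id i) = z i) ∧
          k3HilbertForm 2 z z = 0 ∧ 0 < (k3HilbertForm 2 (star z) z).re ∧
          ∃ u : K3HilbertIndex → ℤ, k3HilbertForm 2 (fun i => (u i : ℂ)) z = 0 ∧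
            0 < ∑ i, ∑ j, u i * k3HilbertGram 2 i j * u j := by
  intro x hxx hxpos hu J hJiso hJinj
  classical
  -- (1) the host embedding `E`
  obtain ⟨E, hEinj, hEiso, hEswap⟩ := exists_hostEmb
  -- `inl : ℚ²² → ℚ²³` as a linear map, and `inl v = Sum.elim v 0`
  set inlQ : (K3Index → ℚ) →ₗ[ℚ] (K3HilbertIndex → ℚ) :=
    (LinearEquiv.sumArrowLequivProdArrow K3Index Unit ℚ ℚ).symm.toLinearMap ∘ₗ
      LinearMap.inl ℚ (K3Index → ℚ) (Unit → ℚ) with hinlQ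
  have inlQ_apply : ∀ v, inlQ v = Sum.elim v 0 := fun v => by
    rw [hinlQ]
    funext i
    rcases i with i | i <;> rfl
  -- (2) the subspace `U = inl(T_x)` and the injective isometry `σ = E ∘ J ∘ pr₁` on it
  set T := trRat x with hT
  set U : Submodule ℚ (K3HilbertIndex → ℚ) := T.map inlQ with hUdef
  set σ : U →ₗ[ℚ] (K3HilbertIndex → ℚ) :=
    (E ∘ₗ J ∘ₗ LinearMap.funLeft ℚ ℚ (Sum.inl : K3Index → K3HilbertIndex)) ∘ₗ U.subtype with hσdef
  have hU : ∀ y : U, ∃ w ∈ T, (y : K3HilbertIndex → ℚ) = Sum.elim w 0 := fun y => by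
    obtain ⟨w, hw, hy⟩ := Submodule.mem_map.1 y.2
    exact ⟨w, hw, by rw [← hy, inlQ_apply]⟩
  have hσ : ∀ (y : U) (w : K3Index → ℚ), (y : K3HilbertIndex → ℚ) = Sum.elim w 0 →
      σ y = E (J w) := by
    intro y w hy
    rw [hσdef, LinearMap.comp_apply, Submodule.subtype_apply, hy]
    rfl
  have hσinj : Function.Injective σ := by
    intro y y' h
    rw [← sub_eq_zero, ← map_sub] at h
    obtain ⟨w, hw, hyw⟩ := hU (y - y')
    rw [hσ _ w hyw] at h
    have hw0 : w = 0 := hJinj w hw (hEinj (by rw [h, map_zero]))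
    rw [← sub_eq_zero]
    apply Subtype.ext
    rw [hyw, hw0]
    funext i
    rcases i with i | i <;> rfl
  have hσq : ∀ y y' : U, Matrix.toBilin' ((k3HilbertGram 2).map (Int.cast : ℤ → ℚ)) (σ y) (σ y') =
      Matrix.toBilin' ((k3HilbertGram 2).map (Int.cast : ℤ → ℚ)) y y' := by
    intro y y'
    obtain ⟨w, hw, hyw⟩ := hU y
    obtain ⟨w', hw', hyw'⟩ := hU y'
    rw [hσ y w hyw, hσ y' w' hyw', hEiso, hJiso w hw w' hw', hyw, hyw', qRat_sumElim]
  -- (3) Witt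
  obtain ⟨τ, hτq, hτU⟩ := Witt_isometry_extension_holds ℚ two_ne_zero (K3HilbertIndex → ℚ)
    (Matrix.toBilin' ((k3HilbertGram 2).map (Int.cast : ℤ → ℚ))) qRat_isSymm qRat_nondegenerate
    U σ hσinj hσq
  -- matrices
  set M := LinearMap.toMatrix' τ.toLinearMap with hM
  set Mc := M.map (fun q : ℚ => (q : ℂ)) with hMc
  have hMτ : ∀ v, M *ᵥ v = τ v := fun v => by
    rw [hM, LinearMap.toMatrix'_mulVec]
    rfl
  have hconj : Mᵀ * (k3HilbertGram 2).map (Int.cast : ℤ → ℚ) * M =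
      (k3HilbertGram 2).map (Int.cast : ℤ → ℚ) :=
    toMatrix_conj_eq (τ := τ.toLinearMap) fun v w => hτq v w
  have hiso : ∀ a b, k3HilbertForm 2 (Mc *ᵥ a) (Mc *ᵥ b) = k3HilbertForm 2 a b :=
    k3HilbertForm_mulVec_mulVec hconj
  have hMcQ : ∀ v : K3HilbertIndex → ℚ,
      Mc *ᵥ (fun i => (v i : ℂ)) = fun i => ((τ v i : ℚ) : ℂ) := fun v => by
    rw [hMc, map_ratCast_mulVec_ratCast, hMτ]
  set z := Mc *ᵥ Sum.elim x 0 with hz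
  refine ⟨τ, z, fun v w => ?_, rfl, ?_, ?_, ?_, ?_⟩
  · -- `g` is an isometry of the complexified form on rational vectors
    rw [k3HilbertForm_ratCast, k3HilbertForm_ratCast, hτq]
  · -- `z` is `I`-invariant: `x ∈ T_x ⊗ ℂ` and `g(inl T_x) = E (J T_x)` is `I`-invariant
    set Φ : (K3Index → ℂ) →ₗ[ℂ] (K3HilbertIndex → ℂ) := (Matrix.mulVecLin Mc) ∘ₗ
      ((LinearEquiv.sumArrowLequivProdArrow K3Index Unit ℂ ℂ).symm.toLinearMap ∘ₗ
        LinearMap.inl ℂ (K3Index → ℂ) (Unit → ℂ)) with hΦ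
    have hΦapply : ∀ y, Φ y = Mc *ᵥ Sum.elim y 0 := fun y => by
      rw [hΦ, LinearMap.comp_apply, Matrix.mulVecLin_apply]
      rfl
    set W : Submodule ℂ (K3HilbertIndex → ℂ) :=
      LinearMap.ker (LinearMap.funLeft ℂ ℂ (Sum.map k3BlockSwap id) - LinearMap.id) with hWdef
    have hW : ∀ y, y ∈ W ↔ ∀ i, y (Sum.map k3BlockSwap id i) = y i := fun y => by
      simp only [hWdef, LinearMap.mem_ker, LinearMap.sub_apply, LinearMap.funLeft_apply,
        LinearMap.id_apply, sub_eq_zero, funext_iff]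
    have hle : Submodule.span ℂ ((fun a : K3Index → ℚ => fun i => (a i : ℂ)) ''
        (trRat x : Set (K3Index → ℚ))) ≤ W.comap Φ := by
      refine Submodule.span_le.2 ?_
      rintro _ ⟨t, ht, rfl⟩
      rw [SetLike.mem_coe, Submodule.mem_comap, hW]
      have hτt := hτU ⟨inlQ t, Submodule.mem_map_of_mem ht⟩
      rw [hσ _ t (inlQ_apply t)] at hτt
      have h1 : Φ (fun i => (t i : ℂ)) = fun i => ((E (J t) i : ℚ) : ℂ) := by
        rw [hΦapply, ← ratCast_sumElim, ← inlQ_apply, hMcQ, hτt]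
      intro i
      rw [h1]
      show ((E (J t) (Sum.map k3BlockSwap id i) : ℚ) : ℂ) = _
      rw [hEswap]
    have hmem := hle (mem_span_trRat x)
    rw [Submodule.mem_comap, hW, hΦapply, ← hz] at hmem
    exact hmem
  · -- `q(z) = (x.x) = 0`
    rw [hz, hiso, k3HilbertForm_inl, hxx]
  · -- `q(z̄, z) = (x̄.x) > 0`
    rw [hz, star_map_ratCast_mulVec, star_sumElim, hiso, k3HilbertForm_inl]
    exact hxpos
  · -- a positive integral vector orthogonal to `z`: clear the denominators of `g(u, 0)`
    obtain ⟨u, hux, hupos⟩ := hu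
    set uQ : K3Index → ℚ := fun i => (u i : ℚ) with huQ
    set r : K3HilbertIndex → ℚ := τ (Sum.elim uQ 0) with hr
    obtain ⟨⟨d, hd⟩, hint⟩ := IsLocalization.exist_integer_multiples_of_finite (nonZeroDivisors ℤ) r
    have hint' : ∀ i, ∃ m : ℤ, (m : ℚ) = (d : ℚ) * r i := fun i => by
      obtain ⟨m, hm⟩ := hint i
      exact ⟨m, by simpa [zsmul_eq_mul] using hm⟩
    choose U' hU' using hint'
    have hd0 : (d : ℚ) ≠ 0 := by exact_mod_cast nonZeroDivisors.ne_zero hd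
    have hUQ : (fun i => (U' i : ℚ)) = (d : ℚ) • r := funext fun i => by
      rw [hU', Pi.smul_apply, smul_eq_mul]
    have hru : Mc *ᵥ Sum.elim (fun i => (u i : ℂ)) 0 = fun i => ((r i : ℚ) : ℂ) := by
      have h0 : (Sum.elim (fun i => (u i : ℂ)) 0 : K3HilbertIndex → ℂ) =
          fun i => ((Sum.elim uQ (0 : Unit → ℚ) i : ℚ) : ℂ) := by
        rw [ratCast_sumElim]
        simp [huQ]
      rw [h0, hMcQ]
    refine ⟨U', ?_, ?_⟩
    · have hUc : (fun i => (U' i : ℂ)) = (d : ℂ) • Mc *ᵥ Sum.elim (fun i => (u i : ℂ)) 0 := by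
        rw [hru]
        funext i
        simp only [Pi.smul_apply, smul_eq_mul]
        rw [show (U' i : ℂ) = ((U' i : ℚ) : ℂ) by norm_cast, hU' i]
        push_cast
        ring
      rw [hUc, k3HilbertForm_smul_left, hz, hiso, k3HilbertForm_inl, hux, mul_zero]
    · have h1 : ((∑ i, ∑ j, U' i * k3HilbertGram 2 i j * U' j : ℤ) : ℚ) =
          (d : ℚ) ^ 2 * Matrix.toBilin' ((k3HilbertGram 2).map (Int.cast : ℤ → ℚ)) r r := by
        rw [← qRat_intCast, hUQ, LinearMap.BilinForm.smul_left, LinearMap.BilinForm.smul_right]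
        ring
      have h2 : Matrix.toBilin' ((k3HilbertGram 2).map (Int.cast : ℤ → ℚ)) r r =
          ((∑ i, ∑ j, u i * k3Gram i j * u j : ℤ) : ℚ) := by
        rw [hr, hτq, qRat_sumElim, huQ, k3FormRat_intCast]
      have h3 : (0 : ℚ) < ((∑ i, ∑ j, U' i * k3HilbertGram 2 i j * U' j : ℤ) : ℚ) := by
        rw [h1, h2]
        exact mul_pos (by positivity) (by exact_mod_cast hupos)
      exact_mod_cast h3

end Summit.HodgeConjecture.HodgeConjecture.Theorems.NikulinTwinTransport

end
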